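import Summits.ResolutionOfSingularities.ResolutionOfSingularities.Theorems.HilbertSamuelEliminationCampaignW42ToricMarkedFanStar
import Summits.ResolutionOfSingularities.ResolutionOfSingularities.Theorems.HilbertSamuelEliminationCampaignW42ToricMarkedActive

/-!
# [OURS · L1 W4.2] Toric marked monomial objects in dimension 3 — brick 8: THE BRIDGE to `IdeasL1Idea2R8.cornerPuzzle` and the ROW
# `InitialCornerSolvable`

[OURS · L1 W4.2 · seat res-L1-s42-pv-2 gen 5] Memo `L/res-L1-s42-pv-2/CALIBRATION-W42-O2-v4.md` §4/§7.  The simulation between the id/vector model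
and idea-2's heights-form stages (res-type-022's hoist `…Corridor3SigmaCornerPuzzle`): a stage `S : HStage` REPRESENTS a vector state when its
corners are injective labellings of the state's cones carrying the rays' vectors and heights (`Represents`, `Rep`); with the exponent dictionary the
boards' sums are face sums (`sum_coord_eq`), so `Won (c.board A) ↔ Won` and `IsPermissible ↔` the legal inequality; in a FAN state the vector naming
is faithful, so `c.Contains (vec '' R) ↔ R ⊆ C` and the `R`-slots are the labels in `R`; hence an ACTIVE-LEGAL face gives a legal move of
`cornerPuzzle A` (`legal_of_legalA`), `HStage.blowup` of the vectors of `R` represents the blown-up state (`rep_move`), and an active-legal play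
ending all-won makes the stage solvable (`solvable_of_playA`).  With `playA_won` (brick 7F), the fan property (7D–7E) and the dictionary (7C):
**`initialCornerSolvable_holds : InitialCornerSolvable`** — card M's first open row (the model-side corner row of the E4 cell of
`stub_Wtop_elimination`) is a THEOREM.  What this is NOT: a statement about schemes or about resolution in characteristic `p` (the exactness
dictionary between the toric model and the blow-up process, r-50 / E4c, is untouched); [Hironaka2017] is a CANDIDATE, never a premise.  AI work,
weaker than expert review.  No `sorry`, no new axiom; axioms of `initialCornerSolvable_holds` = {propext, Classical.choice, Quot.sound}.
-/

set_option linter.dupNamespace false -- mandated namespace of this single-conjunct summit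

namespace Summit.ResolutionOfSingularities.ResolutionOfSingularities.Theorems.CampaignW42.Toric

open Finset
open Literature.Combinatorics.HironakaPolyhedraGame
open Summit.ResolutionOfSingularities.ResolutionOfSingularities.Cruxes.SigmaMaxModifications.IdeasL1Idea2R8

namespace VState

variable {A : Finset (Fin 3 → ℚ)}

/-! ### Representation of heights-form corners by id-cones -/

/-- **[OURS · L1 W4.2]** The heights-form corner `c` (card M / `IdeasL1Idea2R8.HCone`) REPRESENTS the id-cone `C` of the vector state `s`:
its three slots are an injective labelling of `C` carrying the rays' vectors and heights. -/
def Represents (s : VState {v // v ∈ A}) (c : HCone) (C : Finset ℕ) : Prop :=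
  ∃ e : Fin 3 → ℕ, Function.Injective e ∧ Finset.univ.image e = C ∧ (∀ k, c.ray k = s.vec (e k)) ∧ (∀ k, c.height k = s.ht (e k))

/-- **[OURS · L1 W4.2]** The stage `S` REPRESENTS the state `s`: every corner of `S` represents a cone of `s` and every cone of `s` is represented. -/
def Rep (s : VState {v // v ∈ A}) (S : HStage) : Prop :=
  (∀ c ∈ S, ∃ C ∈ s.cones, s.Represents c C) ∧ (∀ C ∈ s.cones, ∃ c ∈ S, s.Represents c C)

/-- Board coordinates are exponents divided by the marking (exponent dictionary). -/
theorem coord_eq {m : ℕ} {s : VState {v // v ∈ A}} (hd : s.Dict m (fun v => v.1)) {c : HCone} {e : Fin 3 → ℕ}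
    (hray : ∀ k, c.ray k = s.vec (e k)) (hht : ∀ k, c.height k = s.ht (e k)) (v : {v // v ∈ A}) (k : Fin 3) :
    (m : ℚ) * coord v.1 c.ray c.height k = (s.expo (e k) v : ℚ) := by
  rw [hd (e k) v]
  unfold coord qexpo
  rw [hray k, hht k]

/-- Sums of board coordinates over a set of slots are face sums of the labelled face. -/
theorem sum_coord_eq {m : ℕ} {s : VState {v // v ∈ A}} (hd : s.Dict m (fun v => v.1)) {c : HCone} {e : Fin 3 → ℕ}
    (he : Function.Injective e) (hray : ∀ k, c.ray k = s.vec (e k)) (hht : ∀ k, c.height k = s.ht (e k)) (v : {v // v ∈ A})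
    (T : Finset (Fin 3)) : (m : ℚ) * ∑ k ∈ T, coord v.1 c.ray c.height k = (s.faceSum (T.image e) v : ℚ) := by
  unfold TState.faceSum
  rw [Finset.sum_image (fun x _ y _ h => he h), Finset.mul_sum]
  push_cast
  exact Finset.sum_congr rfl (fun k _ => coord_eq hd hray hht v k)

/-- **Won ↔ won.**  The heights-form corner is won (polyhedra game, `≤ 1`) iff the represented cone is won (`Σ a ≤ m`). -/
theorem won_board_iff {m : ℕ} (hm : 0 < m) {s : VState {v // v ∈ A}} (hd : s.Dict m (fun v => v.1)) {c : HCone} {C : Finset ℕ}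
    (h : s.Represents c C) : Won (c.board A) ↔ s.Won m C := by
  obtain ⟨e, he, himg, hray, hht⟩ := h
  have hmq : (0 : ℚ) < m := by exact_mod_cast hm
  unfold HCone.board TState.Won
  constructor
  · rintro ⟨a, ha, hsum⟩
    rw [Finset.mem_image] at ha
    obtain ⟨v, hv, rfl⟩ := ha
    refine ⟨⟨v, hv⟩, ?_⟩
    have h1 := sum_coord_eq hd he hray hht ⟨v, hv⟩ Finset.univ
    rw [himg] at h1
    have h2 : (m : ℚ) * ∑ k, coord v c.ray c.height k ≤ m * 1 := mul_le_mul_of_nonneg_left hsum hmq.le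
    rw [h1, mul_one] at h2
    exact_mod_cast h2
  · rintro ⟨v, hv⟩
    refine ⟨coord v.1 c.ray c.height, Finset.mem_image.mpr ⟨v.1, v.2, rfl⟩, ?_⟩
    have h1 := sum_coord_eq hd he hray hht v Finset.univ
    rw [himg] at h1
    have h2 : (s.faceSum C v : ℚ) ≤ m := by exact_mod_cast hv
    rw [← h1] at h2
    by_contra hlt
    push Not at hlt
    have : (m : ℚ) * 1 < m * ∑ k, coord v.1 c.ray c.height k := mul_lt_mul_of_pos_left hlt hmq
    linarith

/-- **Permissible ↔ legal inequality.** -/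
theorem isPermissible_board_iff {m : ℕ} (hm : 0 < m) {s : VState {v // v ∈ A}} (hd : s.Dict m (fun v => v.1)) {c : HCone}
    {e : Fin 3 → ℕ} (he : Function.Injective e) (hray : ∀ k, c.ray k = s.vec (e k)) (hht : ∀ k, c.height k = s.ht (e k))
    (T : Finset (Fin 3)) : IsPermissible (c.board A) T ↔ ∀ v, (m : ℤ) ≤ s.faceSum (T.image e) v := by
  have hmq : (0 : ℚ) < m := by exact_mod_cast hm
  unfold IsPermissible HCone.board
  constructor
  · intro h v
    have h0 := h (coord v.1 c.ray c.height) (Finset.mem_image.mpr ⟨v.1, v.2, rfl⟩)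
    have h1 := sum_coord_eq hd he hray hht v T
    have h2 : (m : ℚ) * 1 ≤ m * ∑ k ∈ T, coord v.1 c.ray c.height k := mul_le_mul_of_nonneg_left h0 hmq.le
    rw [h1, mul_one] at h2
    exact_mod_cast h2
  · intro h a ha
    rw [Finset.mem_image] at ha
    obtain ⟨v, hv, rfl⟩ := ha
    have h1 := sum_coord_eq hd he hray hht ⟨v, hv⟩ T
    have h2 : (m : ℚ) ≤ s.faceSum (T.image e) ⟨v, hv⟩ := by exact_mod_cast h ⟨v, hv⟩
    rw [← h1] at h2
    by_contra hlt
    push Not at hlt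
    have : (m : ℚ) * ∑ k ∈ T, coord v c.ray c.height k < m * 1 := mul_lt_mul_of_pos_left hlt hmq
    linarith

/-- In a fan, the slots of a representing corner whose vectors lie in `vec '' R` are exactly the labels in `R`. -/
theorem slots_eq {s : VState {v // v ∈ A}} (hf : s.IsFan) {c : HCone} {C R C₀ : Finset ℕ} (hC : C ∈ s.cones) (hC₀ : C₀ ∈ s.cones)
    (hRC₀ : R ⊆ C₀) {e : Fin 3 → ℕ} (himg : Finset.univ.image e = C) (hray : ∀ k, c.ray k = s.vec (e k)) :
    c.slots (R.image s.vec) = Finset.univ.filter (fun k => e k ∈ R) := by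
  unfold HCone.slots
  ext k
  simp only [Finset.mem_filter, Finset.mem_univ, true_and, Finset.mem_image, hray k]
  constructor
  · rintro ⟨r, hr, hrk⟩
    have hek : e k ∈ C := by rw [← himg]; exact Finset.mem_image_of_mem e (Finset.mem_univ k)
    have := hf.vec_injective hC₀ hC (hRC₀ hr) hek hrk
    rw [← this]; exact hr
  · intro hk; exact ⟨e k, hk, rfl⟩

/-- In a fan, a representing corner contains the vectors of the face `R` iff the represented cone contains `R`. -/
theorem contains_iff {s : VState {v // v ∈ A}} (hf : s.IsFan) {c : HCone} {C R C₀ : Finset ℕ} (hC : C ∈ s.cones)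
    (hC₀ : C₀ ∈ s.cones) (hRC₀ : R ⊆ C₀) {e : Fin 3 → ℕ} (himg : Finset.univ.image e = C)
    (hray : ∀ k, c.ray k = s.vec (e k)) : c.Contains (R.image s.vec) ↔ R ⊆ C := by
  unfold HCone.Contains
  constructor
  · intro h r hr
    have := h (Finset.mem_image_of_mem _ hr)
    rw [Finset.mem_image] at this
    obtain ⟨k, -, hk⟩ := this
    rw [hray k] at hk
    have hek : e k ∈ C := by rw [← himg]; exact Finset.mem_image_of_mem e (Finset.mem_univ k)
    have := hf.vec_injective hC hC₀ hek (hRC₀ hr) hk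
    rw [← this]; exact hek
  · intro h w hw
    rw [Finset.mem_image] at hw ⊢
    obtain ⟨r, hr, rfl⟩ := hw
    have hrC : r ∈ Finset.univ.image e := by rw [himg]; exact h hr
    obtain ⟨k, -, hk⟩ := Finset.mem_image.mp hrC
    exact ⟨k, Finset.mem_univ k, by rw [hray k, hk]⟩

/-- The image of the `R`-slots under the labelling is `C ∩ R`. -/
theorem image_slots {C R : Finset ℕ} {e : Fin 3 → ℕ} (himg : Finset.univ.image e = C) :
    (Finset.univ.filter (fun k => e k ∈ R)).image e = C ∩ R := by
  ext r
  simp only [Finset.mem_image, Finset.mem_filter, Finset.mem_univ, true_and, Finset.mem_inter]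
  constructor
  · rintro ⟨k, hk, rfl⟩
    exact ⟨by rw [← himg]; exact Finset.mem_image_of_mem e (Finset.mem_univ k), hk⟩
  · rintro ⟨hrC, hrR⟩
    rw [← himg, Finset.mem_image] at hrC
    obtain ⟨k, -, rfl⟩ := hrC
    exact ⟨k, hrR, rfl⟩

/-! ### One blow-up: legality and representation of the blown-up stage -/

/-- **Their legality from ours.**  If `S` represents the fan state `s` with the dictionary, an ACTIVE-LEGAL face `R` of `s` gives a legal move
`vec '' R` of `cornerPuzzle A` at `S`. -/
theorem legal_of_legalA {m : ℕ} (hm : 0 < m) {s : VState {v // v ∈ A}} {S : HStage} (hrep : s.Rep S) (hf : s.IsFan)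
    (hd : s.Dict m (fun v => v.1)) {R : Finset ℕ} (hR : s.toTState.LegalA m R) :
    (cornerPuzzle A).legal S (R.image s.vec) := by
  obtain ⟨⟨⟨hne, -⟩, hineq⟩, C₀, hC₀, hRC₀, hact⟩ := hR
  refine ⟨hne.image _, ?_, ?_⟩
  · obtain ⟨c, hcS, hrepc⟩ := hrep.2 C₀ hC₀
    obtain ⟨e, he, himg, hray, hht⟩ := hrepc
    refine ⟨c, hcS, (contains_iff hf hC₀ hC₀ hRC₀ himg hray).mpr hRC₀, ?_⟩
    rw [won_board_iff hm hd ⟨e, he, himg, hray, hht⟩]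
    exact hact
  · intro c hcS hcont
    obtain ⟨C, hC, e, he, himg, hray, hht⟩ := hrep.1 c hcS
    have hRC : R ⊆ C := (contains_iff hf hC hC₀ hRC₀ himg hray).mp hcont
    rw [isPermissible_board_iff hm hd he hray hht, slots_eq hf hC hC₀ hRC₀ himg hray, image_slots himg,
      Finset.inter_eq_right.mpr hRC]
    exact hineq

/-- The child of a representing corner at an `R`-slot represents the corresponding child cone of the blown-up state. -/
theorem represents_child {m : ℕ} {s : VState {v // v ∈ A}} {c : HCone} {C R : Finset ℕ} (hC : s.next ∉ C) (hRC : R ⊆ C)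
    {e : Fin 3 → ℕ} (he : Function.Injective e) (himg : Finset.univ.image e = C) (hray : ∀ k, c.ray k = s.vec (e k))
    (hht : ∀ k, c.height k = s.ht (e k)) {k₀ : Fin 3} (hk₀ : e k₀ ∈ R) :
    (s.move m R).Represents (c.child (Finset.univ.filter (fun k => e k ∈ R)) k₀) (insert s.next (C.erase (e k₀))) := by
  have hTimg : (Finset.univ.filter (fun k => e k ∈ R)).image e = R := by
    rw [image_slots himg, Finset.inter_eq_right.mpr hRC]
  have hnotrange : ∀ k, e k ≠ s.next := fun k h =>
    hC (by rw [← himg]; exact Finset.mem_image.mpr ⟨k, Finset.mem_univ k, h⟩)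
  refine ⟨Function.update e k₀ s.next, ?_, ?_, ?_, ?_⟩
  · -- injectivity
    intro k k' hkk
    by_cases h1 : k = k₀ <;> by_cases h2 : k' = k₀
    · rw [h1, h2]
    · subst h1; rw [Function.update_self, Function.update_of_ne h2] at hkk; exact absurd hkk.symm (hnotrange k')
    · subst h2; rw [Function.update_self, Function.update_of_ne h1] at hkk; exact absurd hkk (hnotrange k)
    · rw [Function.update_of_ne h1, Function.update_of_ne h2] at hkk; exact he hkk
  · -- image
    ext r
    simp only [Finset.mem_image, Finset.mem_univ, true_and, Finset.mem_insert, Finset.mem_erase]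
    constructor
    · rintro ⟨k, rfl⟩
      by_cases h1 : k = k₀
      · subst h1; left; rw [Function.update_self]
      · right; rw [Function.update_of_ne h1]
        exact ⟨fun h => h1 (he h), by rw [← himg]; exact Finset.mem_image_of_mem e (Finset.mem_univ k)⟩
    · rintro (rfl | ⟨hne, hrC⟩)
      · exact ⟨k₀, by rw [Function.update_self]⟩
      · rw [← himg, Finset.mem_image] at hrC
        obtain ⟨k, -, rfl⟩ := hrC
        exact ⟨k, by rw [Function.update_of_ne (fun h => hne (by rw [h]))]⟩
  · -- rays
    intro k
    by_cases h1 : k = k₀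
    · subst h1
      simp only [HCone.child, Function.update_self]
      funext i
      rw [vec_move_next, Finset.sum_apply]
      conv_rhs => rw [← hTimg, Finset.sum_image (fun x _ y _ h => he h)]
      exact Finset.sum_congr rfl (fun t _ => by rw [hray t])
    · simp only [HCone.child, Function.update_of_ne h1]
      rw [vec_move_of_ne (hnotrange k), hray k]
  · -- heights
    intro k
    by_cases h1 : k = k₀
    · subst h1
      simp only [HCone.child, Function.update_self]
      rw [ht_move_next]
      conv_rhs => rw [← hTimg, Finset.sum_image (fun x _ y _ h => he h)]
      exact congrArg _ (Finset.sum_congr rfl (fun t _ => by rw [hht t]))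
    · simp only [HCone.child, Function.update_of_ne h1]
      rw [ht_move_of_ne (hnotrange k), hht k]

/-- An untouched representing corner still represents its cone after the blow-up. -/
theorem represents_move_of_not_mem {m : ℕ} {s : VState {v // v ∈ A}} {c : HCone} {C R : Finset ℕ} (hC : s.next ∉ C)
    (h : s.Represents c C) : (s.move m R).Represents c C := by
  obtain ⟨e, he, himg, hray, hht⟩ := h
  have hnotrange : ∀ k, e k ≠ s.next := fun k h =>
    hC (by rw [← himg]; exact Finset.mem_image.mpr ⟨k, Finset.mem_univ k, h⟩)
  exact ⟨e, he, himg, fun k => by rw [vec_move_of_ne (hnotrange k), hray k], fun k => by rw [ht_move_of_ne (hnotrange k), hht k]⟩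

/-- Membership in a blown-up stage. -/
theorem mem_blowup_iff {S : HStage} {Rv : Finset (Fin 3 → ℤ)} {c' : HCone} :
    c' ∈ S.blowup Rv ↔ ∃ c ∈ S, c' ∈ c.blowup Rv := by
  unfold HStage.blowup
  rw [List.mem_flatten]
  constructor
  · rintro ⟨l, hl, hc'⟩
    rw [List.mem_map] at hl
    obtain ⟨c, hc, rfl⟩ := hl
    exact ⟨c, hc, hc'⟩
  · rintro ⟨c, hc, hc'⟩
    exact ⟨c.blowup Rv, List.mem_map.mpr ⟨c, hc, rfl⟩, hc'⟩

/-- **Representation is preserved by a legal blow-up** (in a fan state). -/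
theorem rep_move {m : ℕ} {s : VState {v // v ∈ A}} {S : HStage} (hrep : s.Rep S) (hf : s.IsFan) (hwf : s.WF) {R : Finset ℕ}
    (hR : s.toTState.Legal m R) : (s.move m R).Rep (S.blowup (R.image s.vec)) := by
  classical
  obtain ⟨⟨-, C₀, hC₀, hRC₀⟩, -⟩ := hR
  constructor
  · intro c' hc'
    rw [mem_blowup_iff] at hc'
    obtain ⟨c, hcS, hc'⟩ := hc'
    obtain ⟨C, hC, e, he, himg, hray, hht⟩ := hrep.1 c hcS
    have hnC : s.next ∉ C := hwf.next_notMem hC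
    by_cases hRC : R ⊆ C
    · have hcont : c.Contains (R.image s.vec) := (contains_iff hf hC hC₀ hRC₀ himg hray).mpr hRC
      unfold HCone.blowup at hc'
      rw [if_pos hcont, List.mem_map] at hc'
      obtain ⟨k₀, hk₀, rfl⟩ := hc'
      rw [Finset.mem_toList, slots_eq hf hC hC₀ hRC₀ himg hray, Finset.mem_filter] at hk₀
      refine ⟨insert s.next (C.erase (e k₀)), ?_, ?_⟩
      · rw [move_toTState, TState.mem_move_cones]
        exact ⟨C, hC, by rw [TState.children_of_subset hRC]; exact Finset.mem_image_of_mem _ hk₀.2⟩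
      · rw [slots_eq hf hC hC₀ hRC₀ himg hray]
        exact represents_child hnC hRC he himg hray hht hk₀.2
    · have hcont : ¬ c.Contains (R.image s.vec) := fun h => hRC ((contains_iff hf hC hC₀ hRC₀ himg hray).mp h)
      unfold HCone.blowup at hc'
      rw [if_neg hcont, List.mem_singleton] at hc'
      subst hc'
      refine ⟨C, ?_, represents_move_of_not_mem hnC ⟨e, he, himg, hray, hht⟩⟩
      rw [move_toTState, TState.mem_move_cones]
      exact ⟨C, hC, by rw [TState.children_of_not_subset hRC]; exact Finset.mem_singleton_self _⟩
  · intro D hD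
    rw [move_toTState, TState.mem_move_cones] at hD
    obtain ⟨C, hC, hDC⟩ := hD
    obtain ⟨c, hcS, e, he, himg, hray, hht⟩ := hrep.2 C hC
    have hnC : s.next ∉ C := hwf.next_notMem hC
    by_cases hRC : R ⊆ C
    · rw [TState.children_of_subset hRC, Finset.mem_image] at hDC
      obtain ⟨x, hx, rfl⟩ := hDC
      have hxC : x ∈ Finset.univ.image e := by rw [himg]; exact hRC hx
      obtain ⟨k₀, -, rfl⟩ := Finset.mem_image.mp hxC
      have hcont : c.Contains (R.image s.vec) := (contains_iff hf hC hC₀ hRC₀ himg hray).mpr hRC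
      refine ⟨c.child (c.slots (R.image s.vec)) k₀, ?_, ?_⟩
      · rw [mem_blowup_iff]
        refine ⟨c, hcS, ?_⟩
        unfold HCone.blowup
        rw [if_pos hcont, List.mem_map]
        refine ⟨k₀, ?_, rfl⟩
        rw [Finset.mem_toList, slots_eq hf hC hC₀ hRC₀ himg hray, Finset.mem_filter]
        exact ⟨Finset.mem_univ _, hx⟩
      · rw [slots_eq hf hC hC₀ hRC₀ himg hray]
        exact represents_child hnC hRC he himg hray hht hx
    · rw [TState.children_of_not_subset hRC, Finset.mem_singleton] at hDC
      subst hDC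
      have hcont : ¬ c.Contains (R.image s.vec) := fun h => hRC ((contains_iff hf hC hC₀ hRC₀ himg hray).mp h)
      refine ⟨c, ?_, represents_move_of_not_mem hnC ⟨e, he, himg, hray, hht⟩⟩
      rw [mem_blowup_iff]
      refine ⟨c, hcS, ?_⟩
      unfold HCone.blowup
      rw [if_neg hcont]; exact List.mem_singleton_self _

/-! ### The simulation and the row -/

/-- **SIMULATION.**  An active-legal play of the id-model from a fan state represented (with the dictionary) by the stage `S`, ending in an all-won
state, makes `S` solvable in `cornerPuzzle A`. -/
theorem solvable_of_playA {m : ℕ} (hm : 0 < m) :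
    ∀ (s₀ t : TState {v // v ∈ A}), s₀.PlayA m t → (∀ C ∈ t.cones, t.Won m C) →
      ∀ (s : VState {v // v ∈ A}) (S : HStage), s.toTState = s₀ → s.IsFan → s.WF → s.Dict m (fun v => v.1) → s.Rep S →
        (cornerPuzzle A).Solvable S := by
  intro s₀ t hplay
  induction hplay with
  | refl s₀ =>
    intro hwon s S hs hf hwf hd hrep
    subst hs
    refine ⟨0, ?_⟩
    show ∀ c ∈ S, Won (c.board A)
    intro c hc
    obtain ⟨C, hC, hrepc⟩ := hrep.1 c hc
    rw [won_board_iff hm hd hrepc]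
    exact hwon C hC
  | step R hRA _ ih =>
    intro hwon s S hs hf hwf hd hrep
    subst hs
    obtain ⟨k, hk⟩ := ih hwon (s.move m R) (S.blowup (R.image s.vec)) rfl (hf.move hwf R) (TState.WF.move hwf R) (hd.move R)
      (rep_move hrep hf hwf hRA.1)
    refine ⟨k + 1, Or.inr ⟨R.image s.vec, legal_of_legalA hm hrep hf hd hRA, hk⟩⟩

/-- The standard stage `initialHStage` represents the initial vector state of a position. -/
theorem rep_initial (m : ℕ) (hm : ∀ v ∈ A, ∀ k : Fin 3, ∃ z : ℤ, (v k) * m = z) : (ofPosition A m hm).Rep initialHStage := by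
  have hrep : (ofPosition A m hm).Represents { ray := fun i j => if i = j then 1 else 0, height := fun _ => 0 } {0, 1, 2} := by
    refine ⟨fun k => k.val, Fin.val_injective, by decide, fun k => ?_, fun k => rfl⟩
    funext j
    show (if k = j then (1 : ℤ) else 0) = (if h : (k.val) < 3 then (if (⟨k.val, h⟩ : Fin 3) = j then 1 else 0) else 0)
    rw [dif_pos k.isLt]
  have hcones : (ofPosition A m hm).cones = {{0, 1, 2}} := rfl
  constructor
  · intro c hc
    unfold initialHStage at hc
    rw [List.mem_singleton] at hc
    subst hc
    exact ⟨{0, 1, 2}, by rw [hcones]; exact Finset.mem_singleton_self _, hrep⟩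
  · intro C hC
    rw [hcones, Finset.mem_singleton] at hC
    subst hC
    exact ⟨_, List.mem_singleton_self _, hrep⟩

/-- **[OURS · L1 W4.2] THE ROW.**  `IdeasL1Idea2R8.InitialCornerSolvable` holds: for every position of the polyhedra game (nothing is used of the
hypothesis `¬ Won A`), the corner puzzle is solvable from the standard corner — toric order reduction of the marked monomial ideal (bricks 1–6)
transported through the fan property and the exponent dictionary (bricks 7) and re-threaded to active-legal plays (brick 7F). -/
theorem initialCornerSolvable_holds : InitialCornerSolvable := by
  intro A hA _
  obtain ⟨m, hmpos, hm⟩ := TState.exists_common_denominator A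
  obtain ⟨v₀, hv₀⟩ := hA.1
  haveI : Nonempty {v // v ∈ A} := ⟨⟨v₀, hv₀⟩⟩
  have hnn : (TState.ofPosition A m hm).Nonneg := by
    intro r v
    unfold TState.ofPosition
    refine TState.initial_nonneg _ (fun k v => ?_) r v
    have h1 : (0 : ℚ) ≤ v.1 k * m := mul_nonneg (hA.2 v.1 v.2 k) (by exact_mod_cast hmpos.le)
    have h2 := TState.ofPosition_spec hm v k
    have : (0 : ℚ) ≤ ((Classical.choose (hm v.1 v.2 k) : ℤ) : ℚ) := by rw [h2]; exact h1
    exact_mod_cast this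
  obtain ⟨t, hplay, hwon⟩ := TState.playA_won hmpos (TState.ofPosition A m hm) (TState.initial_WF _) hnn
  exact solvable_of_playA hmpos _ t hplay hwon (ofPosition A m hm) initialHStage rfl (isFan_ofPosition A m hm)
    (TState.initial_WF _) (dict_ofPosition A m hm) (rep_initial m hm)

end VState

end Summit.ResolutionOfSingularities.ResolutionOfSingularities.Theorems.CampaignW42.Toric
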